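import Literature.MathematicalPhysics.QuantumFieldTheory.Balaban1983to89.Node00.CarriersB8CubeDentedRec
import Literature.MathematicalPhysics.QuantumFieldTheory.Balaban1983to89.Node00.TorusCoverGaugeLiftShift
import Literature.MathematicalPhysics.QuantumFieldTheory.Balaban1983to89.B8Eq131CubesRecDictionary
import Literature.MathematicalPhysics.QuantumFieldTheory.Balaban1983to89.B8Ineq159FlatDentedCubeMemberPrinted

/-!
# NODE 00 — [Balaban1985Variational] (144)–(150)'s DENTED cube datum FOR THE RECORD's CENTRED TOWER ([Balaban1987RG1] (0.3)), READ THROUGH THE (T2) TRANSLATION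
# `x ↦ x + ctrShift L k·𝟙`: print's constraint-bond class `CubeB8DZ.lamBPZ` ([Balaban1984PropagatorsII] (2.3)), the TRANSLATED ENGINE DATUM `CubeB8DZ.translate :
# CubeB8DZ d L K Ω → CubeB8D d L K (Ω + c_k·𝟙)` and its dictionary (tower, block law, cells, class, dent premise) — the `CubeB8DZ → CubeB8D` repackaging announced in
# `Node00/CarriersB8CubeDentedRec` §4, by which the RECORD twins of the engine's flat named facts on the dented member are obtained by translation (N05-REC R6 (e)′-2∕(e)′-3)

statement-level skeleton of published theorems with citation tags; proofs where landed; nothing here is a claim about the Yang–Mills mass gap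

CITATION HEADER (lean-in-tree rule).  Cell `pub-ymgap` (HUMAN RULING D-0062), «N05-REC» road (director-ym №254∕№255; LEAD PEN dag-n05-e g38; desk `R6-PLAN.md` §2 rows
(e)′-2∕(e)′-3).  [15] = [Balaban1985Variational] p. 300, (144) p. 300, (148)–(152) p. 301; [6] = [Balaban1985RegularSpaces] (1.3)–(1.6) p. 77, (1.31) p. 82, (1.131) p. 99,
p. 98; [B6] = [Balaban1984PropagatorsII] (2.3) p. 224; [I] = [Balaban1987RG1] (0.3) p. 252 (CENTRED blocks «Bᵏ(y) = {x : |x_μ − Lᵏy_μ| ≤ (Lᵏ−1)∕2}»).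
`--kind definition --supports stmt-QuantumFields-20541` (K0⁷; count-neutral).  REUSED BY NAME: `Node00.CubeB8D ∕ .sq ∕ .inTop ∕ .lamS ∕ .lamBP` (p655171, p659892) and
`Node00.CubeB8DZ ∕ .sq ∕ .inTop ∕ .lamS` with dag-n07-w3's §4 dictionary `mem_sq_iff_add_ctrShift`, `inTop_iff_under_add_ctrShift`, `blocks_flm_add_ctrShift` (p711135);
`B8Eq131CubesRecDictionary.{inBox_sqZ_iff_add_ctrShift, inBox_inZ_iff_add_ctrShift, underZ_iff_under_add_ctrShift, image_add_ctrShift_tcubeZ}` and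
`Node00.TorusCoverGaugeLiftShift.bondTouches_translate_iff` (dag-n07-w3).
WHY.  For the SAME datum `(a, M, ρ, k; {Ω_j})` the record's dented tower `CubeB8DZ.sq ∕ lamS` (centred boxes and blocks) is the ENGINE's dented tower of the TRANSLATED
ambient family `Ω_j + c_k·𝟙`, read through `x ↦ x + c_k·𝟙` (fine sites) and `z ↦ z + c_{k−j}·𝟙` (level-`j` labels, `c_k = Lʲc_{k−j} + c_j`); the centred block law becomes
the corner one (`flm L k (x + c_k) = flmZ L k x`), «□̃ ⊂ Ω_{k−1}» is preserved (`(· + c_k) '' tcubeZ = tcube`), and the dent premise «`Ω_k` a union of big cubes of the grid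
anchored at `□_k`'s fine lower corner» moves its anchor from the record's `Lᵏ(a − ρ) − c_k` to the engine's `Lᵏ(a − ρ)`.  So every ENGINE theorem on `CubeB8D` data at
the flat background (translation-covariant letters) yields its RECORD twin on `CubeB8DZ` data by evaluation at `c.translate` — the use made of this file by
`B8Ineq159FlatDentedCubeMemberPrintedRec` ((1.59)) and `B8Real123CubeMemberRec` ((1.91)–(1.101)).
WHAT IS PROVED (sorry-free).  §1 def `CubeB8DZ.lamBPZ` (twin of `CubeB8D.lamBP`) + `mem_lamBPZ_iff` (`Iff.rfl`).  §2 `tcube_subset_image_add_ctrShift`,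
`blocks_image_add_ctrShift`, def ★ `CubeB8DZ.translate` + `translate_k ∕ _a ∕ _M ∕ _ρ` (`rfl`), `mem_translate_sq_iff`, ★ `image_add_ctrShift_sq` (`Ω′_j + c_k = (c.translate).sq j`),
`under_translate_iff`, ★ `translate_inTop_iff`, ★ `mem_lamS_iff_add_ctrShift` ∕ `image_add_ctrShift_lamS` (`Λ′_j + c_{k−j} = (c.translate).lamS j`), ★ `mem_lamBPZ_iff_add_ctrShift`,
★ `anchored_translate`.
HONEST SCOPE.  Definitions + set bookkeeping; no estimate; nothing of [6]∕[15]∕[B6]∕[I] asserted; `HThm4Rec` UNDISCHARGED; N05 ∕ N07 NOT discharged; counts unmoved (typed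
28∕28 · discharged 8∕28); one finite 𝕋⁴ programme at fixed ε — nothing continuum ∕ ℝ⁴ ∕ OS ∕ mass gap ∕ Clay.  No `instance`, no `notation`, no `sorry`.
-/

set_option autoImplicit false
noncomputable section

namespace Literature.MathematicalPhysics.QuantumFieldTheory.Balaban1983to89.Node00

open B7Prop1Explicit (e)
open B7Prop1Local (InBox)
open BlockAveragingZd (ctrShift)
open Literature.MathematicalPhysics.QuantumLattice (blockMap)
open B8Ineq132 (BondTouches Under)
open B8Eq131Cubes (cube sqLo sqHi inLo inHi tcube flm)
open B8Eq131CubesRec (sqLoZ sqHiZ inLoZ inHiZ tcubeZ)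
open B8Eq131CubesRecDictionary (inBox_sqZ_iff_add_ctrShift inBox_inZ_iff_add_ctrShift underZ_iff_under_add_ctrShift image_add_ctrShift_tcubeZ)
open B8Eq131CubesAdmissible (cubeFam)
open B8Eq119TwistedAxialRec (UnderZ flmZ)

variable {d : ℕ}

/-! ## §1 Print's constraint-bond class on the dented RECORD tower (top truncation) -/

section Class

variable {L K : ℕ} {Ω : ℕ → Set (B7Prop1Explicit.Site d)}

/-- (RECORD TWIN of `Node00.CubeB8D.lamBP`.) **PRINT'S CONSTRAINT-BOND CLASS AT LEVEL `j` OF THE DENTED RECORD TOWER `{Ω′_j}`** (top truncation `m = k`; [B6] (2.3) for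
bonds, [6] (1.31)'s contours, read on [15]'s local sequence (148)–(150), CENTRED label boxes and blocks): a level-`j` bond `b = ⟨b₋, b₋ + e_κ⟩`, `j ≤ k`, with AT LEAST ONE
end in `(Ω′_j)^{(j)}` — `□_j^{(j)} = [sqLoZ j, sqHiZ j]` for `j < k`, the `k`-sites of `□_k^{(k)}` whose CENTRED `k`-block lies in `Ω_k` at `j = k` — and, when `j < k`, NO end
inside `(Ω′_{j+1})^{(j)}`.  The comprehension of `CubeB8DZ.lamS` (p711135) with «the site» replaced by «an end of the bond»; the engine's `CubeB8D.lamBP` under the token map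
`sqLo sqHi inLo inHi Under ↦ sqLoZ sqHiZ inLoZ inHiZ UnderZ`.
[cite: Balaban1984PropagatorsII, (2.3) p.224; Balaban1985RegularSpaces, (1.31) p.82, (1.131) p.99; Balaban1985Variational, (148)–(150) p.301; Balaban1987RG1, (0.3) p.252] -/
def CubeB8DZ.lamBPZ (c : CubeB8DZ d L K Ω) (j : ℕ) :
    Set (B7Prop1Explicit.Site d × Fin d) :=
  {b | j ≤ c.k ∧
    ((InBox (sqLoZ L c.a c.ρ c.k j) (sqHiZ L c.a c.M c.ρ c.k j) b.1 ∧ (j = c.k → ∀ x, UnderZ L j b.1 x → x ∈ Ω c.k)) ∨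
      (InBox (sqLoZ L c.a c.ρ c.k j) (sqHiZ L c.a c.M c.ρ c.k j) (b.1 + e b.2) ∧ (j = c.k → ∀ x, UnderZ L j (b.1 + e b.2) x → x ∈ Ω c.k))) ∧
    (j < c.k →
      ¬ (InBox (inLoZ L c.a c.ρ c.k j) (inHiZ L c.a c.M c.ρ c.k j) b.1 ∧ (j + 1 = c.k → ∀ x, UnderZ L j b.1 x → x ∈ Ω c.k)) ∧
      ¬ (InBox (inLoZ L c.a c.ρ c.k j) (inHiZ L c.a c.M c.ρ c.k j) (b.1 + e b.2) ∧ (j + 1 = c.k → ∀ x, UnderZ L j (b.1 + e b.2) x → x ∈ Ω c.k)))}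

variable (c : CubeB8DZ d L K Ω)

/-- Membership, unfolded (`Iff.rfl`). [cite: Balaban1984PropagatorsII, (2.3) p.224; Balaban1985Variational, (148)–(150) p.301; Balaban1987RG1, (0.3) p.252] -/
theorem CubeB8DZ.mem_lamBPZ_iff (j : ℕ) (b : B7Prop1Explicit.Site d × Fin d) :
    b ∈ c.lamBPZ j ↔ j ≤ c.k ∧
      ((InBox (sqLoZ L c.a c.ρ c.k j) (sqHiZ L c.a c.M c.ρ c.k j) b.1 ∧ (j = c.k → ∀ x, UnderZ L j b.1 x → x ∈ Ω c.k)) ∨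
        (InBox (sqLoZ L c.a c.ρ c.k j) (sqHiZ L c.a c.M c.ρ c.k j) (b.1 + e b.2) ∧ (j = c.k → ∀ x, UnderZ L j (b.1 + e b.2) x → x ∈ Ω c.k))) ∧
      (j < c.k →
        ¬ (InBox (inLoZ L c.a c.ρ c.k j) (inHiZ L c.a c.M c.ρ c.k j) b.1 ∧ (j + 1 = c.k → ∀ x, UnderZ L j b.1 x → x ∈ Ω c.k)) ∧
        ¬ (InBox (inLoZ L c.a c.ρ c.k j) (inHiZ L c.a c.M c.ρ c.k j) (b.1 + e b.2) ∧ (j + 1 = c.k → ∀ x, UnderZ L j (b.1 + e b.2) x → x ∈ Ω c.k))) :=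
  Iff.rfl

end Class

/-! ## §2 The translated ENGINE datum of a record datum, and the (T2) dictionary -/

section Translate

variable {L K : ℕ} {Ω : ℕ → Set (B7Prop1Explicit.Site d)}

/-- `x + t ∈ S + t ↔ x ∈ S`. [folklore] [cite: Balaban1987RG1, (0.3) p.252 (bookkeeping)] -/
private theorem add_mem_image_add_iff (S : Set (B7Prop1Explicit.Site d)) (t x : B7Prop1Explicit.Site d) : x + t ∈ (fun y => y + t) '' S ↔ x ∈ S :=
  ⟨fun ⟨y, hy, h⟩ => by rwa [← add_right_cancel h], fun hx => ⟨x, hx, rfl⟩⟩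

/-- `x ∈ S + t ↔ x − t ∈ S`. [folklore] [cite: Balaban1987RG1, (0.3) p.252 (bookkeeping)] -/
private theorem mem_image_add_iff (S : Set (B7Prop1Explicit.Site d)) (t x : B7Prop1Explicit.Site d) : x ∈ (fun y => y + t) '' S ↔ x - t ∈ S := by
  rw [← add_mem_image_add_iff S t (x - t), sub_add_cancel]

/-- The prelude's block map at block size `Lʲ` is `flm L j`. [folklore] [cite: Balaban1985RegularSpaces, (1.6) p.77] -/
private theorem blockMap_pow_eq_flm (L j : ℕ) (x : B7Prop1Explicit.Site d) : blockMap (L ^ j) x = flm L j x := by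
  funext i; simp [blockMap, flm]

/-- «□̃ ⊂ Ω_{k−1}» survives the translation: `tcube L a M ρ k ⊆ Ω_{k−1} + c_k·𝟙` (odd `L`; `(· + c_k) '' tcubeZ = tcube`).
[cite: Balaban1985Variational, (144) p.300; Balaban1987RG1, (0.3) p.252] -/
theorem CubeB8DZ.tcube_subset_image_add_ctrShift (hL : Odd L) (c : CubeB8DZ d L K Ω) :
    tcube L c.a c.M c.ρ c.k ⊆ (fun x : B7Prop1Explicit.Site d => x + fun _ => (ctrShift L c.k : ℤ)) '' Ω (c.k - 1) := by
  rw [← image_add_ctrShift_tcubeZ hL c.a c.M c.ρ c.k]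
  exact Set.image_mono c.tcube_sub

/-- The CENTRED block law of `Ω_k` is the CORNER block law of `Ω_k + c_k·𝟙` (odd `L`; `flm L k (x + c_k) = flmZ L k x`).
[cite: Balaban1985RegularSpaces, (1.3) p.77; Balaban1987RG1, (0.3) p.252] -/
theorem CubeB8DZ.blocks_image_add_ctrShift (hL : Odd L) (c : CubeB8DZ d L K Ω) ⦃x y : B7Prop1Explicit.Site d⦄
    (hxy : blockMap (L ^ c.k) x = blockMap (L ^ c.k) y) (hx : x ∈ (fun w : B7Prop1Explicit.Site d => w + fun _ => (ctrShift L c.k : ℤ)) '' Ω c.k) :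
    y ∈ (fun w : B7Prop1Explicit.Site d => w + fun _ => (ctrShift L c.k : ℤ)) '' Ω c.k := by
  have hx0 : (x - fun _ => (ctrShift L c.k : ℤ)) ∈ Ω c.k := (mem_image_add_iff _ _ _).1 hx
  have hflm : flm L c.k ((x - fun _ => (ctrShift L c.k : ℤ)) + fun _ => (ctrShift L c.k : ℤ)) =
      flm L c.k ((y - fun _ => (ctrShift L c.k : ℤ)) + fun _ => (ctrShift L c.k : ℤ)) := by
    rw [sub_add_cancel, sub_add_cancel, ← blockMap_pow_eq_flm, ← blockMap_pow_eq_flm]; exact hxy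
  exact (mem_image_add_iff _ _ _).2 (c.blocks_flm_add_ctrShift hL hflm hx0)

/-- ★ **THE TRANSLATED ENGINE DATUM** (odd `L`): the record datum `c = (k, a, M, ρ; {Ω_j})` read as an ENGINE dented cube datum of the translated ambient family
`{Ω_j + c_k·𝟙}` — same `k, a, M, ρ` and size laws, «□̃ ⊂ Ω_{k−1}» by `tcube_subset_image_add_ctrShift`, the block law by `blocks_image_add_ctrShift`.
[cite: Balaban1985Variational, p.300, (144) p.300, (148)–(150) p.301; Balaban1985RegularSpaces, p.98, (1.3) p.77; Balaban1987RG1, (0.3) p.252] -/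
def CubeB8DZ.translate (hL : Odd L) (c : CubeB8DZ d L K Ω) :
    CubeB8D d L K (fun j => (fun x : B7Prop1Explicit.Site d => x + fun _ => (ctrShift L c.k : ℤ)) '' Ω j) :=
  ⟨c.k, c.a, c.M, c.ρ, c.one_le_k, c.k_le, c.L_le_ρ, c.ρ_le_M, c.big, c.L_le_dM, CubeB8DZ.tcube_subset_image_add_ctrShift hL c, CubeB8DZ.blocks_image_add_ctrShift hL c⟩

variable (c : CubeB8DZ d L K Ω)

/-- Same scale index. [cite: Balaban1985Variational, p.300 (bookkeeping)] -/
@[simp] theorem CubeB8DZ.translate_k (hL : Odd L) : (c.translate hL).k = c.k := rfl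
/-- Same corner. [cite: Balaban1985Variational, p.300 (bookkeeping)] -/
@[simp] theorem CubeB8DZ.translate_a (hL : Odd L) : (c.translate hL).a = c.a := rfl
/-- Same side. [cite: Balaban1985Variational, p.300 (bookkeeping)] -/
@[simp] theorem CubeB8DZ.translate_M (hL : Odd L) : (c.translate hL).M = c.M := rfl
/-- Same collar width. [cite: Balaban1985Variational, p.300 (bookkeeping)] -/
@[simp] theorem CubeB8DZ.translate_ρ (hL : Odd L) : (c.translate hL).ρ = c.ρ := rfl

/-- The dented tower of the translated datum, unfolded: `y ∈ (c.translate).sq j ↔ y ∈ cubeFam false L a M ρ k j ∧ (j = k → y − c_k ∈ Ω_k)`.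
[cite: Balaban1985Variational, (148)–(150) p.301; Balaban1987RG1, (0.3) p.252] -/
theorem CubeB8DZ.mem_translate_sq_iff (hL : Odd L) (j : ℕ) (y : B7Prop1Explicit.Site d) :
    y ∈ (c.translate hL).sq j ↔ y ∈ cubeFam false L c.a c.M c.ρ c.k j ∧ (j = c.k → (y - fun _ => (ctrShift L c.k : ℤ)) ∈ Ω c.k) := by
  simp only [CubeB8D.sq, Set.mem_inter_iff, Set.mem_setOf_eq, CubeB8DZ.translate_k, CubeB8DZ.translate_a, CubeB8DZ.translate_M, CubeB8DZ.translate_ρ, mem_image_add_iff]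

/-- ★ **The record's dented tower is the translated datum's, through `x ↦ x + c_k·𝟙`** (odd `L`, every `j`): `Ω′_j + c_k·𝟙 = (c.translate).sq j`.
[cite: Balaban1985Variational, (148)–(150) p.301; Balaban1985RegularSpaces, (1.131) p.99; Balaban1987RG1, (0.3) p.252] -/
theorem CubeB8DZ.image_add_ctrShift_sq (hL : Odd L) (j : ℕ) :
    (fun x : B7Prop1Explicit.Site d => x + fun _ => (ctrShift L c.k : ℤ)) '' c.sq j = (c.translate hL).sq j := by
  ext y
  rw [CubeB8DZ.mem_translate_sq_iff]
  constructor
  · rintro ⟨x, hx, rfl⟩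
    rw [add_sub_cancel_right]
    exact (c.mem_sq_iff_add_ctrShift hL j x).1 hx
  · intro hy
    refine ⟨y - fun _ => (ctrShift L c.k : ℤ), ?_, sub_add_cancel y _⟩
    rw [c.mem_sq_iff_add_ctrShift hL, sub_add_cancel]
    exact hy

/-- The block condition «the `j`-block of the label lies in `Ω_k`» through the translation (odd `L`, `j ≤ k`): engine corner block of `z + c_{k−j}` against `Ω_k + c_k` iff
record centred block of `z` against `Ω_k`. [cite: Balaban1987RG1, (0.3) p.252; Balaban1985RegularSpaces, (1.6) p.77] -/
theorem CubeB8DZ.under_translate_iff (hL : Odd L) {j : ℕ} (hjk : j ≤ c.k) (z : B7Prop1Explicit.Site d) :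
    (∀ x, Under L j (z + fun _ => (ctrShift L (c.k - j) : ℤ)) x → x ∈ (fun w : B7Prop1Explicit.Site d => w + fun _ => (ctrShift L c.k : ℤ)) '' Ω c.k) ↔
      (∀ x, UnderZ L j z x → x ∈ Ω c.k) := by
  constructor
  · intro h x hx
    exact (add_mem_image_add_iff _ _ _).1 (h _ ((underZ_iff_under_add_ctrShift hL hjk z x).1 hx))
  · intro h x hx
    rw [mem_image_add_iff]
    refine h _ ((underZ_iff_under_add_ctrShift hL hjk z _).2 ?_)
    rwa [sub_add_cancel]

/-- ★ **`inTop` is invariant**: the translated datum's «corner `k`-block of `z` in `Ω_k + c_k`» iff the record's «centred `k`-block of `z` in `Ω_k`» (same label `z`: the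
level-`k` label shift is `c_0 = 0`). [cite: Balaban1987RG1, (0.3) p.252; Balaban1985RegularSpaces, (1.3)/(1.6) p.77] -/
theorem CubeB8DZ.translate_inTop_iff (hL : Odd L) (z : B7Prop1Explicit.Site d) : (c.translate hL).inTop z ↔ c.inTop z := by
  rw [c.inTop_iff_under_add_ctrShift hL]
  unfold CubeB8D.inTop
  simp only [CubeB8DZ.translate_k]
  constructor
  · intro h x hx
    exact (add_mem_image_add_iff _ _ _).1 (h _ hx)
  · intro h x hx
    rw [mem_image_add_iff]
    refine h _ ?_
    rwa [sub_add_cancel]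

/-- ★ **The cells through the label shift** (odd `L`, every `j`): `z ∈ Λ′_j(record) ↔ z + c_{k−j} ∈ Λ′_j(translated engine datum)`.
[cite: Balaban1985Variational, (148) p.301; Balaban1985RegularSpaces, (1.131) p.99, (1.5) p.77; Balaban1987RG1, (0.3) p.252] -/
theorem CubeB8DZ.mem_lamS_iff_add_ctrShift (hL : Odd L) (j : ℕ) (z : B7Prop1Explicit.Site d) :
    z ∈ c.lamS j ↔ (z + fun _ => (ctrShift L (c.k - j) : ℤ)) ∈ (c.translate hL).lamS j := by
  by_cases hjk : j ≤ c.k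
  · have h1 : c.lamS j = {z | InBox (sqLoZ L c.a c.ρ c.k j) (sqHiZ L c.a c.M c.ρ c.k j) z ∧ (j = c.k → ∀ x, UnderZ L j z x → x ∈ Ω c.k) ∧
        (j < c.k → ¬ (InBox (inLoZ L c.a c.ρ c.k j) (inHiZ L c.a c.M c.ρ c.k j) z ∧ (j + 1 = c.k → ∀ x, UnderZ L j z x → x ∈ Ω c.k)))} := by
      simp only [CubeB8DZ.lamS, if_pos hjk]
    have h2 : (c.translate hL).lamS j = {z | InBox (sqLo L c.a c.ρ c.k j) (sqHi L c.a c.M c.ρ c.k j) z ∧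
        (j = c.k → ∀ x, Under L j z x → x ∈ (fun w : B7Prop1Explicit.Site d => w + fun _ => (ctrShift L c.k : ℤ)) '' Ω c.k) ∧
        (j < c.k → ¬ (InBox (inLo L c.a c.ρ c.k j) (inHi L c.a c.M c.ρ c.k j) z ∧
          (j + 1 = c.k → ∀ x, Under L j z x → x ∈ (fun w : B7Prop1Explicit.Site d => w + fun _ => (ctrShift L c.k : ℤ)) '' Ω c.k)))} := by
      simp only [CubeB8D.lamS, CubeB8DZ.translate_k, CubeB8DZ.translate_a, CubeB8DZ.translate_M, CubeB8DZ.translate_ρ, if_pos hjk]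
    rw [h1, h2, Set.mem_setOf_eq, Set.mem_setOf_eq, inBox_sqZ_iff_add_ctrShift, inBox_inZ_iff_add_ctrShift, CubeB8DZ.under_translate_iff c hL hjk]
  · have h1 : c.lamS j = ∅ := by simp only [CubeB8DZ.lamS, if_neg hjk]
    have h2 : (c.translate hL).lamS j = ∅ := by simp only [CubeB8D.lamS, CubeB8DZ.translate_k, if_neg hjk]
    rw [h1, h2]
    simp only [Set.mem_empty_iff_false]

/-- The same as an identity of sets: `Λ′_j(record) + c_{k−j}·𝟙 = Λ′_j(translated datum)`. [cite: Balaban1985Variational, (148) p.301; Balaban1987RG1, (0.3) p.252] -/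
theorem CubeB8DZ.image_add_ctrShift_lamS (hL : Odd L) (j : ℕ) :
    (fun z : B7Prop1Explicit.Site d => z + fun _ => (ctrShift L (c.k - j) : ℤ)) '' c.lamS j = (c.translate hL).lamS j := by
  ext y
  constructor
  · rintro ⟨z, hz, rfl⟩
    exact (CubeB8DZ.mem_lamS_iff_add_ctrShift c hL j z).1 hz
  · intro hy
    refine ⟨y - fun _ => (ctrShift L (c.k - j) : ℤ), ?_, sub_add_cancel y _⟩
    rw [CubeB8DZ.mem_lamS_iff_add_ctrShift c hL, sub_add_cancel]
    exact hy

/-- ★ **Print's bond class through the label shift** (odd `L`): `⟨z, κ⟩ ∈ c.lamBPZ j ↔ ⟨z + c_{k−j}, κ⟩ ∈ (c.translate).lamBP j`.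
[cite: Balaban1984PropagatorsII, (2.3) p.224; Balaban1985Variational, (148)–(150) p.301; Balaban1987RG1, (0.3) p.252] -/
theorem CubeB8DZ.mem_lamBPZ_iff_add_ctrShift (hL : Odd L) (j : ℕ) (b : B7Prop1Explicit.Site d × Fin d) :
    b ∈ c.lamBPZ j ↔ ((b.1 + fun _ => (ctrShift L (c.k - j) : ℤ)), b.2) ∈ (c.translate hL).lamBP j := by
  rw [CubeB8DZ.mem_lamBPZ_iff, B8Ineq159FlatDentedCubeMemberPrinted.mem_lamBP_iff]
  by_cases hjk : j ≤ c.k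
  · simp only [CubeB8DZ.translate_k, CubeB8DZ.translate_a, CubeB8DZ.translate_M, CubeB8DZ.translate_ρ]
    rw [add_right_comm b.1 _ (e b.2), inBox_sqZ_iff_add_ctrShift, inBox_sqZ_iff_add_ctrShift, inBox_inZ_iff_add_ctrShift, inBox_inZ_iff_add_ctrShift,
      CubeB8DZ.under_translate_iff c hL hjk, CubeB8DZ.under_translate_iff c hL hjk]
  · simp only [CubeB8DZ.translate_k, hjk, false_and]

/-- ★ **The dent premise through the translation**: if `Ω_k` is saturated for the cubes of side `B` of the grid anchored at the RECORD's fine lower corner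
`Lᵏ(a − ρ) − c_k·𝟙` of `□_k`'s blow-up, then `Ω_k + c_k·𝟙` is saturated for the cubes of side `B` anchored at the ENGINE's corner `Lᵏ(a − ρ)` ([6] (1.4)₂ «Ω_j is a sum of
cubes of a size M₁Lʲη» on the grid carrying `□_k`). [cite: Balaban1985RegularSpaces, (1.4) p.77, p.98; Balaban1985Variational, p.300; Balaban1987RG1, (0.3) p.252] -/
theorem CubeB8DZ.anchored_translate {B : ℕ}
    (h : ∀ x y : B7Prop1Explicit.Site d,
      blockMap B (x - fun i => (L : ℤ) ^ c.k * (c.a i - c.ρ) - (ctrShift L c.k : ℤ)) =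
        blockMap B (y - fun i => (L : ℤ) ^ c.k * (c.a i - c.ρ) - (ctrShift L c.k : ℤ)) → x ∈ Ω c.k → y ∈ Ω c.k) :
    ∀ x y : B7Prop1Explicit.Site d,
      blockMap B (x - fun i => (L : ℤ) ^ c.k * (c.a i - c.ρ)) = blockMap B (y - fun i => (L : ℤ) ^ c.k * (c.a i - c.ρ)) →
        x ∈ (fun w : B7Prop1Explicit.Site d => w + fun _ => (ctrShift L c.k : ℤ)) '' Ω c.k →
        y ∈ (fun w : B7Prop1Explicit.Site d => w + fun _ => (ctrShift L c.k : ℤ)) '' Ω c.k := by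
  intro x y hxy hx
  rw [mem_image_add_iff] at hx ⊢
  have hsub : ∀ w : B7Prop1Explicit.Site d,
      ((w - fun _ => (ctrShift L c.k : ℤ)) - fun i => (L : ℤ) ^ c.k * (c.a i - c.ρ) - (ctrShift L c.k : ℤ)) = w - fun i => (L : ℤ) ^ c.k * (c.a i - c.ρ) := by
    intro w; funext i; simp only [Pi.sub_apply]; ring
  refine h _ _ ?_ hx
  rw [hsub, hsub]
  exact hxy

end Translate


end Literature.MathematicalPhysics.QuantumFieldTheory.Balaban1983to89.Node00

end
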